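import Summits.CriticalPhenomena.PercolationContinuityZ3.Theorems.PercNearOneGluingNoHeavyLowerTailAntitheticSepCodes
import Summits.CriticalPhenomena.PercolationContinuityZ3.Theorems.PercNearOneGluingNoHeavyLowerTailAntitheticShiftDecide
import Mathlib.Data.List.TakeWhile
import HarnessLib

/-!
# `NoHeavyLowerTail` (stmt-CriticalPhenomena-4575) — antithetic cluster pairs: SOUNDNESS OF SEPARABLE ("flow ⊗ flow") CERTIFICATES for
# shifted-BIC positivity (prim-hp-2 gen 67, HOME/MEMO-gen67.md §3)

Support file (`--supports stmt-CriticalPhenomena-4575`, hull-port prover `prim-hp-2`, gen 67).  No definitions (the computable data is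
…AntitheticSepCodes), no named facts, no sorries; standard axioms.

A separable certificate (…AntitheticSepCodes) writes `N · W = Σ c · (e_b − e_a)(e_{b'} − e_{a'})ᵀ` with `a ⊆ b`, `a' ⊆ b'` bitwise and
`c ≥ 0`; then for all `F, G` monotone along bitwise inclusion `N · F ᵀ W G = Σ c (F b − F a)(G b' − G a') ≥ 0`.  Compared with the kernel
DECISION of …AntitheticShiftDecide (all monotone Boolean functions of `m ≤ 4` free coordinates, plus a condition on the "top" points) this is a
CERTIFICATE: no bound on the number of coordinates, no shape condition, cost `O(K log K)` in the certificate size — the format for cores on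
7 vertices (`K_{2,5}`, `W₆`, the 5-fan) and for every 6-vertex core violating the top condition.  Existence of a certificate = membership of
`W` in the tensor square of the dual monotone cone, an LP (HOME/code/gen67/kit67/sepx); every shifted-BIC-positive gadget tested so far has one
(MEMO-gen67 §3).
* `Antithetic.SepCert.runsZero_sound` — a list passing the run checker has `Σ c · φ(key) = 0` for every `φ`;
* `Antithetic.SepCert.sum_monosW`, `sum_monosC` — the monomial sums evaluate `N · FᵀWG` and minus the certificate's value;
* `Antithetic.SepCert.sep_sound` — **soundness**: `check n N h cert = true` ⇒ `0 ≤ Σ_{(x,y,m) ∈ h} m (F x − F y)(G x − G y)` for all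
  `F, G : ℕ → ℝ` monotone along `&&&`-inclusion;
* `Antithetic.SepCert.shift_nonneg_of_sep` — the bridge to set functions: shape hypotheses `X a = base ∪ v(xs a)`, `Y a = base ∪ v(ys a)`,
  histogram identity, `check` ⇒ `0 ≤ Σ_{a ∈ D} (F⁺(X a) − F⁻(Y a))(G⁺(X a) − G⁻(Y a))` for all monotone nested real set functions
  (the hypothesis shape of …AntitheticTransportShift / …HandleDualShift consumers, exactly as `ShiftDecide.shift_nonneg_of_check`).
[cite: VandenbergHaggstromKahn2005, §1 p. 6 ("Harris' inequality")]
-/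

namespace Summit.CriticalPhenomena.PercolationContinuityZ3.Theorems

namespace Antithetic

namespace SepCert

open ShiftDecide

/-- Evaluation of monomial lists is additive under concatenation. [this work] -/
theorem ev_append (φ : ℕ → ℝ) (l l' : List (ℕ × ℤ)) :
    ((l ++ l').map fun p => (p.2 : ℝ) * φ p.1).sum = (l.map fun p => (p.2 : ℝ) * φ p.1).sum + (l'.map fun p => (p.2 : ℝ) * φ p.1).sum := by
  simp [List.map_append, List.sum_append]

/-- A run of monomials with a common key evaluates to `(Σ c) · φ key`. [this work] -/
theorem ev_of_all_key (φ : ℕ → ℝ) (k : ℕ) : ∀ (l : List (ℕ × ℤ)), (∀ p ∈ l, p.1 = k) →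
    (l.map fun p => (p.2 : ℝ) * φ p.1).sum = ((l.map Prod.snd).sum : ℤ) * φ k
  | [], _ => by simp
  | p :: l, h => by
    rw [List.map_cons, List.sum_cons, List.map_cons, List.sum_cons, Int.cast_add, add_mul,
      ev_of_all_key φ k l fun q hq => h q (List.mem_cons_of_mem _ hq), h p List.mem_cons_self]

/-- **Soundness of the run checker**: `runsZero l = true` ⇒ `Σ_{(k,c) ∈ l} c · φ k = 0` for every `φ`. [this work] -/
theorem runsZero_sound (φ : ℕ → ℝ) : ∀ (n : ℕ) (l : List (ℕ × ℤ)), l.length ≤ n → runsZero l = true →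
    (l.map fun p => (p.2 : ℝ) * φ p.1).sum = 0
  | _, [], _, _ => by simp
  | 0, (p :: l), hl, _ => by simp at hl
  | n + 1, ((k, c) :: t), hl, h => by
    rw [runsZero, Bool.and_eq_true, beq_iff_eq] at h
    obtain ⟨h1, h2⟩ := h
    have hsplit : t = t.takeWhile (fun p => p.1 == k) ++ t.dropWhile (fun p => p.1 == k) := List.takeWhile_append_dropWhile.symm
    have hlen : (t.dropWhile fun p => p.1 == k).length ≤ n :=
      (List.dropWhile_suffix _).length_le.trans (by simp only [List.length_cons] at hl; omega)
    have ih := runsZero_sound φ n _ hlen h2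
    rw [List.map_cons, List.sum_cons]
    conv_lhs => rw [hsplit]
    rw [ev_append]
    have hrun : ((t.takeWhile fun p => p.1 == k).map fun p => (p.2 : ℝ) * φ p.1).sum =
        (((t.takeWhile fun p => p.1 == k).map Prod.snd).sum : ℤ) * φ k :=
      ev_of_all_key φ k _ fun q hq => by simpa using List.mem_takeWhile_imp hq
    rw [hrun, ih, add_zero, ← add_mul]
    have : ((c : ℤ) : ℝ) + (((t.takeWhile fun p => p.1 == k).map Prod.snd).sum : ℤ) = ((c + ((t.takeWhile fun p => p.1 == k).map Prod.snd).sum : ℤ) : ℝ) := by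
      push_cast; ring
    rw [show ((k, c) : ℕ × ℤ).2 = c from rfl, show ((k, c) : ℕ × ℤ).1 = k from rfl, this, h1]
    simp

/-- Keys decode (first component) when the second code is `< 2^n`. [this work] -/
theorem key_div (n : ℕ) {u v : ℕ} (hv : v < 2 ^ n) : key n u v / 2 ^ n = u := by
  rw [key, Nat.add_comm, Nat.add_mul_div_right _ _ (Nat.two_pow_pos n), Nat.div_eq_of_lt hv, Nat.zero_add]

/-- Keys decode (second component). [this work] -/
theorem key_mod (n : ℕ) {u v : ℕ} (hv : v < 2 ^ n) : key n u v % 2 ^ n = v := by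
  rw [key, Nat.add_comm, Nat.add_mul_mod_self_right, Nat.mod_eq_of_lt hv]

/-- The `W`-monomials evaluate to `N · Σ m (F x − F y)(G x − G y)`. [this work] -/
theorem sum_monosW (n N : ℕ) (F G φ : ℕ → ℝ) (hφ : ∀ u v : ℕ, v < 2 ^ n → φ (key n u v) = F u * G v) :
    ∀ (h : List (ℕ × ℕ × ℕ)), (∀ e ∈ h, e.1 < 2 ^ n ∧ e.2.1 < 2 ^ n) →
    ((monosW n N h).map fun p => (p.2 : ℝ) * φ p.1).sum =
      (N : ℝ) * (h.map fun e => (e.2.2 : ℝ) * ((F e.1 - F e.2.1) * (G e.1 - G e.2.1))).sum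
  | [], _ => by simp [monosW]
  | e :: h, hh => by
    have he := hh e List.mem_cons_self
    have ih := sum_monosW n N F G φ hφ h fun e' he' => hh e' (List.mem_cons_of_mem _ he')
    rw [monosW, List.flatMap_cons, List.map_append, List.sum_append, ← monosW, ih]
    simp only [List.map_cons, List.map_nil, List.sum_cons, List.sum_nil, hφ _ _ he.1, hφ _ _ he.2]
    push_cast
    ring

/-- The certificate monomials evaluate to MINUS the certificate value `Σ c (F b − F a)(G b' − G a')`. [this work] -/
theorem sum_monosC (n : ℕ) (F G φ : ℕ → ℝ) (hφ : ∀ u v : ℕ, v < 2 ^ n → φ (key n u v) = F u * G v) :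
    ∀ (cert : List (ℕ × ℕ × ℕ × ℕ × ℕ)),
    (∀ e ∈ cert, e.1 < 2 ^ n ∧ e.2.1 < 2 ^ n ∧ e.2.2.1 < 2 ^ n ∧ e.2.2.2.1 < 2 ^ n) →
    ((monosC n cert).map fun p => (p.2 : ℝ) * φ p.1).sum =
      -(cert.map fun e => (e.2.2.2.2 : ℝ) * ((F e.2.1 - F e.1) * (G e.2.2.2.1 - G e.2.2.1))).sum
  | [], _ => by simp [monosC]
  | e :: cert, hh => by
    have he := hh e List.mem_cons_self
    have ih := sum_monosC n F G φ hφ cert fun e' he' => hh e' (List.mem_cons_of_mem _ he')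
    rw [monosC, List.flatMap_cons, List.map_append, List.sum_append, ← monosC, ih]
    simp only [List.map_cons, List.map_nil, List.sum_cons, List.sum_nil, hφ _ _ he.2.2.1, hφ _ _ he.2.2.2]
    push_cast
    ring

/-- Bitwise inclusion bounds the code. [this work] -/
theorem le_of_and_eq {a b : ℕ} (h : a &&& b = a) : a ≤ b := by rw [← h]; exact Nat.and_le_right

/-- **SOUNDNESS OF SEPARABLE CERTIFICATES.**  If `check n N h cert = true` then for all `F, G : ℕ → ℝ` monotone along bitwise inclusion,
`0 ≤ Σ_{(x,y,m) ∈ h} m · (F x − F y) · (G x − G y)`. [this work] -/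
theorem sep_sound {n N : ℕ} {h : List (ℕ × ℕ × ℕ)} {cert : List (ℕ × ℕ × ℕ × ℕ × ℕ)} (hc : check n N h cert = true)
    (F G : ℕ → ℝ) (hF : ∀ a b : ℕ, a &&& b = a → F a ≤ F b) (hG : ∀ a b : ℕ, a &&& b = a → G a ≤ G b) :
    0 ≤ (h.map fun e => (e.2.2 : ℝ) * ((F e.1 - F e.2.1) * (G e.1 - G e.2.1))).sum := by
  simp only [check, Bool.and_eq_true, decide_eq_true_eq, List.all_eq_true, beq_iff_eq] at hc
  obtain ⟨⟨⟨hN, hh⟩, hcert⟩, hruns⟩ := hc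
  have hh' : ∀ e ∈ h, e.1 < 2 ^ n ∧ e.2.1 < 2 ^ n := fun e he => hh e he
  have hcert' : ∀ e ∈ cert, e.1 < 2 ^ n ∧ e.2.1 < 2 ^ n ∧ e.2.2.1 < 2 ^ n ∧ e.2.2.2.1 < 2 ^ n := by
    intro e he
    obtain ⟨⟨⟨hb, hb'⟩, ha⟩, ha'⟩ := hcert e he
    exact ⟨(le_of_and_eq ha).trans_lt hb, hb, (le_of_and_eq ha').trans_lt hb', hb'⟩
  -- the pairing read through a key
  let φ : ℕ → ℝ := fun key => F (key / 2 ^ n) * G (key % 2 ^ n)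
  have hφ : ∀ u v : ℕ, v < 2 ^ n → φ (key n u v) = F u * G v := fun u v hv => by
    simp only [φ, key_div n hv, key_mod n hv]
  -- the sorted monomial list evaluates to zero, and sorting is a permutation
  have hzero := runsZero_sound φ _ _ le_rfl hruns
  have hperm : ((monosW n N h ++ monosC n cert).mergeSort fun p q => p.1 ≤ q.1).Perm (monosW n N h ++ monosC n cert) :=
    List.mergeSort_perm _ _
  have hsum : ((monosW n N h ++ monosC n cert).map fun p => (p.2 : ℝ) * φ p.1).sum = 0 := by
    rw [← (hperm.map _).sum_eq]; exact hzero
  rw [List.map_append, List.sum_append, sum_monosW n N F G φ hφ h hh', sum_monosC n F G φ hφ cert hcert'] at hsum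
  -- the certificate value is a sum of nonnegative terms
  have hpos : 0 ≤ (cert.map fun e => (e.2.2.2.2 : ℝ) * ((F e.2.1 - F e.1) * (G e.2.2.2.1 - G e.2.2.1))).sum := by
    refine List.sum_nonneg fun t ht => ?_
    obtain ⟨e, he, rfl⟩ := List.mem_map.1 ht
    obtain ⟨⟨⟨-, -⟩, ha⟩, ha'⟩ := hcert e he
    exact mul_nonneg (Nat.cast_nonneg _) (mul_nonneg (sub_nonneg.2 (hF _ _ ha)) (sub_nonneg.2 (hG _ _ ha')))
  have hNpos : (0 : ℝ) < N := by exact_mod_cast hN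
  have heq : (N : ℝ) * (h.map fun e => (e.2.2 : ℝ) * ((F e.1 - F e.2.1) * (G e.1 - G e.2.1))).sum =
      (cert.map fun e => (e.2.2.2.2 : ℝ) * ((F e.2.1 - F e.1) * (G e.2.2.2.1 - G e.2.2.1))).sum := by linarith
  exact (mul_nonneg_iff_of_pos_left hNpos).1 (heq ▸ hpos)

/-! ### Bridge to monotone nested set functions -/

/-- The coordinate set read off a code is monotone along bitwise inclusion. [this work] -/
theorem dec_mono (k : ℕ) {a b : ℕ} (h : a &&& b = a) :
    (Finset.univ.filter fun i : Fin k => a.testBit i.val) ⊆ Finset.univ.filter fun i : Fin k => b.testBit i.val := by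
  intro i hi
  simp only [Finset.mem_filter, Finset.mem_univ, true_and] at hi ⊢
  have := congrArg (fun x => x.testBit i.val) h
  simp only [Nat.testBit_and] at this
  rw [hi, Bool.true_and] at this
  exact this

/-- Bits are monotone along bitwise inclusion. [this work] -/
theorem testBit_mono {a b : ℕ} (h : a &&& b = a) {j : ℕ} (hj : a.testBit j = true) : b.testBit j = true := by
  have := congrArg (fun x => x.testBit j) h
  simp only [Nat.testBit_and] at this
  rw [hj, Bool.true_and] at this
  exact this

/-- Decoding the code of a coordinate set. [this work] -/
theorem dec_enc (k : ℕ) (S : Finset (Fin k)) : (Finset.univ.filter fun i : Fin k => (enc S).testBit i.val) = S := by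
  ext i; simp [testBit_enc_val]

/-- Decoding the code of a coordinate set with the top bit set. [this work] -/
theorem dec_enc_or (k : ℕ) (S : Finset (Fin k)) : (Finset.univ.filter fun i : Fin k => (enc S ||| 2 ^ k).testBit i.val) = S := by
  ext i
  simp only [Finset.mem_filter, Finset.mem_univ, true_and, Nat.testBit_or, testBit_enc_val, Nat.testBit_two_pow]
  have hne : k ≠ i.val := Nat.ne_of_gt i.isLt
  simp [hne]

/-- The top bit of a coordinate-set code is clear. [this work] -/
theorem testBit_enc_top (k : ℕ) (S : Finset (Fin k)) : (enc S).testBit k = false := testBit_enc_of_le S le_rfl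

/-- The top bit of a marked code is set. [this work] -/
theorem testBit_enc_or_top (k : ℕ) (S : Finset (Fin k)) : (enc S ||| 2 ^ k).testBit k = true := by
  rw [Nat.testBit_or, Nat.testBit_two_pow_self, Bool.or_true]

/-- **Separable certificates ⇒ the shifted-BIC statement for set functions.**  `D` a finite family with red / blue sets
`X a = base ∪ v(xs a)`, `Y a = base ∪ v(ys a)` (`v : Fin k → V` the coordinate vertices), `h` the histogram of the code pairs
`(enc (xs a) ||| 2^k, enc (ys a))` (bit `k` = the point at infinity), `check (k+1) N h cert = true`.  Then for all monotone `F⁻ ≤ F⁺`,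
`G⁻ ≤ G⁺ : Set V → ℝ`: `0 ≤ Σ_{a ∈ D} (F⁺(X a) − F⁻(Y a))·(G⁺(X a) − G⁻(Y a))`. [this work] -/
theorem shift_nonneg_of_sep {ι V : Type*} [DecidableEq V] {k : ℕ} (D : Finset ι) (X Y : ι → Finset V)
    (base : Finset V) (v : Fin k → V) (xs ys : ι → Finset (Fin k))
    (hX : ∀ a ∈ D, X a = base ∪ (xs a).image v) (hY : ∀ a ∈ D, Y a = base ∪ (ys a).image v)
    (h : List (ℕ × ℕ × ℕ)) (hh : D.val.map (fun a => (enc (xs a) ||| 2 ^ k, enc (ys a))) = histMultiset h)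
    {N : ℕ} {cert : List (ℕ × ℕ × ℕ × ℕ × ℕ)} (hc : check (k + 1) N h cert = true)
    (Fp Fm Gp Gm : Set V → ℝ) (hFp : Monotone Fp) (hFm : Monotone Fm) (hF : ∀ S, Fm S ≤ Fp S)
    (hGp : Monotone Gp) (hGm : Monotone Gm) (hG : ∀ S, Gm S ≤ Gp S) :
    0 ≤ ∑ a ∈ D, (Fp ↑(X a) - Fm ↑(Y a)) * (Gp ↑(X a) - Gm ↑(Y a)) := by
  -- the set read off a code, and the test functions on codes
  let setOf : ℕ → Set V := fun u => ↑(base ∪ (Finset.univ.filter fun i : Fin k => u.testBit i.val).image v)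
  have hsetOf : ∀ {a b : ℕ}, a &&& b = a → setOf a ⊆ setOf b := fun hab =>
    Finset.coe_subset.2 (Finset.union_subset_union (le_refl _) (Finset.image_subset_image (dec_mono k hab)))
  let Fh : (Set V → ℝ) → (Set V → ℝ) → ℕ → ℝ := fun Ap Am u => if u.testBit k then Ap (setOf u) else Am (setOf u)
  have hmono : ∀ {Ap Am : Set V → ℝ}, Monotone Ap → Monotone Am → (∀ S, Am S ≤ Ap S) →
      ∀ a b : ℕ, a &&& b = a → Fh Ap Am a ≤ Fh Ap Am b := by
    intro Ap Am hAp hAm hA a b hab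
    simp only [Fh]
    rcases ha : a.testBit k with _ | _
    · rcases hb : b.testBit k with _ | _
      · simp only [Bool.false_eq_true, ↓reduceIte]; exact hAm (hsetOf hab)
      · simp only [Bool.false_eq_true, ↓reduceIte]; exact (hAm (hsetOf hab)).trans (hA _)
    · have hb : b.testBit k = true := testBit_mono hab ha
      simp only [hb, ↓reduceIte]; exact hAp (hsetOf hab)
  have key := sep_sound hc (Fh Fp Fm) (Fh Gp Gm) (hmono hFp hFm hF) (hmono hGp hGm hG)
  -- identify the two sums through the histogram
  have hval : ∀ a ∈ D, (Fp ↑(X a) - Fm ↑(Y a)) * (Gp ↑(X a) - Gm ↑(Y a)) =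
      (fun p : ℕ × ℕ => (Fh Fp Fm p.1 - Fh Fp Fm p.2) * (Fh Gp Gm p.1 - Fh Gp Gm p.2)) (enc (xs a) ||| 2 ^ k, enc (ys a)) := by
    intro a ha
    have h1 : ∀ {Ap Am : Set V → ℝ}, Fh Ap Am (enc (xs a) ||| 2 ^ k) = Ap ↑(X a) := by
      intro Ap Am; simp only [Fh, testBit_enc_or_top, ↓reduceIte, setOf, dec_enc_or, hX a ha]
    have h2 : ∀ {Ap Am : Set V → ℝ}, Fh Ap Am (enc (ys a)) = Am ↑(Y a) := by
      intro Ap Am; simp only [Fh, testBit_enc_top, Bool.false_eq_true, ↓reduceIte, setOf, dec_enc, hY a ha]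
    simp only [h1, h2]
  rw [Finset.sum_congr rfl hval, Finset.sum_eq_multiset_sum]
  have e1 : D.val.map (fun a => (fun p : ℕ × ℕ => (Fh Fp Fm p.1 - Fh Fp Fm p.2) * (Fh Gp Gm p.1 - Fh Gp Gm p.2))
      (enc (xs a) ||| 2 ^ k, enc (ys a))) =
      (D.val.map (fun a => (enc (xs a) ||| 2 ^ k, enc (ys a)))).map
        (fun p : ℕ × ℕ => (Fh Fp Fm p.1 - Fh Fp Fm p.2) * (Fh Gp Gm p.1 - Fh Gp Gm p.2)) := by
    rw [Multiset.map_map]; rfl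
  rw [e1, hh, sum_map_histMultiset]
  exact key

end SepCert

end Antithetic

end Summit.CriticalPhenomena.PercolationContinuityZ3.Theorems
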